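import Literature.Topology.FourManifolds.BallUnionDiscLocalHomology
import Literature.Topology.FourManifolds.WhitneyModelSheets
import Literature.AlgebraicTopology.SingularHomology.LocalHomologyUniverse

/-!
# Aux file 3 of stub `stub_friendsH2` (line `mk_friends`, crux `DcrGap`): transfer of local homology
(item stmt-SmoothPoincare4-16128, route route-SmoothPoincare4-DottedCircleRasmussen)

Local homology `H_q(X | K)` only depends on a neighbourhood of the closed set `K` (Hatcher 2002,
§3.3 p. 233; the tree's `localHomologyOfSet.exists_linearEquiv_pair_of_isOpenEmbedding`).  For the
`H₂`-leaf of the friends lemma (Manolescu–Piccirillo 2023, §3.2) the model handlebody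
`D_k ⊂ ℝ⁴` sits in the closed `4`-manifold `X` only through a GERM chart — a map `i : ℝ⁴ → X`
that is smooth, injective and immersive on an open `U ⊇ D_k` — so this file provides:

* `FriendsH2.isOpenEmbedding_restrict_of_germChart` — `i|_U : U → X` is an open embedding
  (inverse function theorem, the tree's `isLocalDiffeomorphAt_of_mfderiv_injective`, and
  invariance of domain for local homeomorphisms);
* `FriendsH2.nonempty_linearEquiv_of_isOpenEmbedding₂`,
  `FriendsH2.surjective_restrictLocal_iff_of_isOpenEmbedding₂` — transfer of `H_q(· | K)` and of
  the surjectivity of restriction maps between ANY two spaces into which a neighbourhood of `K`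
  openly embeds;
* `FriendsH2.isZero_localHomologyOfSet_smoothDisc` — `H_q(X | f(𝔻²)) = 0` (`q = 2, 3`) for a
  smooth disc `f` in a closed smooth `4`-manifold (the tree's ambient-isotopy shrinking
  `exists_homeomorph_image_disc_eq`, then Hatcher Prop. 2B.1(a) in `S⁴`; word for word the tree's
  `Knot.IsSliceDiscIn.isZero_localHomologyOfSet_disc` with the slice-disc datum unbundled);
* `FriendsH2.isZero_localHomologyOfSet_sphere_image_disc` — the same in `S⁴` for the image under
  the stereographic embedding of an injective continuous disc in `ℝ⁴`.

Everything is proved; no definitions, no named facts, no `sorry`.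

## References

* A. Hatcher, *Algebraic Topology*, CUP 2002, Prop. 2B.1, §3.3 p. 233. [HatcherAT2002]
* J. M. Lee, *Introduction to Smooth Manifolds*, 2nd ed. (2013), Thm. 4.5. [LeeSmoothManifolds2013]
* C. Manolescu, L. Piccirillo, J. Lond. Math. Soc. 108 (2023), §3.2. [ManolescuPiccirillo2023]
-/

-- the prescribed namespace `Summit.<P>.<Sub>.…` duplicates `SmoothPoincare4` (P = Sub)
set_option linter.dupNamespace false
set_option linter.style.longLine false

noncomputable section

open scoped Manifold ContDiff
open CategoryTheory Limits Set Function Metric Topology Filter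
open Literature.AlgebraicTopology.SingularHomology Literature.Topology.FourManifolds

universe u u₁ u₂ u₃

namespace Summit.SmoothPoincare4.SmoothPoincare4.Theorems.DcrGap.MkFriends

namespace FriendsH2

/-- Local notation: the `4`-sphere `S⁴ ⊂ ℝ⁵`. -/
local notation "𝕊⁴" => (Metric.sphere (0 : EuclideanSpace ℝ (Fin 5)) 1)

/-! ## The germ chart is an open embedding of `U` -/

section GermChart

variable {X : Type u} [TopologicalSpace X] [ChartedSpace (EuclideanSpace ℝ (Fin 4)) X]
  [IsManifold (𝓡 4) ∞ X]

/-- **A germ chart is an open embedding**: if `i : ℝ⁴ → X` (`X` a smooth `4`-manifold) is smooth,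
injective and immersive on the open set `U`, then `i|_U : U → X` is an open embedding (each point
of `U` is a local diffeomorphism point by the inverse function theorem, Lee 2013 Thm. 4.5, so
`i|_U` is a continuous injective open map). [cite: LeeSmoothManifolds2013, Thm. 4.5] -/
theorem isOpenEmbedding_restrict_of_germChart {U : Set (EuclideanSpace ℝ (Fin 4))}
    {i : EuclideanSpace ℝ (Fin 4) → X} (hU : IsOpen U)
    (hi : ContMDiffOn (𝓡 4) (𝓡 4) ∞ i U) (hinj : InjOn i U)
    (hd : ∀ x ∈ U, Injective (mfderiv (𝓡 4) (𝓡 4) i x)) :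
    IsOpenEmbedding (U.restrict i) := by
  have hloc : IsLocalDiffeomorphOn (𝓡 4) (𝓡 4) ∞ i U := fun x =>
    isLocalDiffeomorphAt_of_mfderiv_injective hU x.2 hi (by exact_mod_cast le_top) rfl (hd x x.2)
  have hlh : IsLocalHomeomorphOn i U := hloc.isLocalHomeomorphOn
  have hopen : IsOpenMap (U.restrict i) := by
    rw [isOpenMap_iff_nhds_le]
    intro x
    calc 𝓝 (U.restrict i x) = (𝓝 (x : EuclideanSpace ℝ (Fin 4))).map i := (hlh.map_nhds_eq x.2).symm
      _ ≤ ((𝓝 x).map (Subtype.val : U → EuclideanSpace ℝ (Fin 4))).map i :=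
          Filter.map_mono (hU.isOpenMap_subtype_val.nhds_le x)
      _ = (𝓝 x).map (U.restrict i) := Filter.map_map
  exact .of_continuous_injective_isOpenMap (continuousOn_iff_continuous_restrict.1 hi.continuousOn)
    (Set.injOn_iff_injective.1 hinj) hopen

end GermChart

/-! ## Transfer between two spaces containing a neighbourhood of `K` -/

section Transfer

variable (R : Type) [CommRing R] (M : Type) [AddCommGroup M] [Module R M]
variable {O : Type u₁} {Y₁ : Type u₂} {Y₂ : Type u₃}
  [TopologicalSpace O] [TopologicalSpace Y₁] [TopologicalSpace Y₂]

/-- **`H_q(Y₁ | κ₁ K) ≅ H_q(Y₂ | κ₂ K)` for two open embeddings `κ₁ : O → Y₁`, `κ₂ : O → Y₂`** of a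
neighbourhood `O` of `K` (Hatcher 2002, §3.3 p. 233). [cite: HatcherAT2002, §3.3 p. 233] -/
theorem nonempty_linearEquiv_of_isOpenEmbedding₂ {κ₁ : O → Y₁} {κ₂ : O → Y₂}
    (h₁ : IsOpenEmbedding κ₁) (h₂ : IsOpenEmbedding κ₂) {K : Set O}
    (hK₁ : IsClosed (κ₁ '' K)) (hK₂ : IsClosed (κ₂ '' K)) (q : ℕ) :
    Nonempty (localHomologyOfSet R M Y₁ (κ₁ '' K) q ≃ₗ[R] localHomologyOfSet R M Y₂ (κ₂ '' K) q) := by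
  obtain ⟨T₁, -, -⟩ := localHomologyOfSet.exists_linearEquiv_pair_of_isOpenEmbedding R M h₁
    (subset_refl K) hK₁ hK₁ q
  obtain ⟨T₂, -, -⟩ := localHomologyOfSet.exists_linearEquiv_pair_of_isOpenEmbedding R M h₂
    (subset_refl K) hK₂ hK₂ q
  exact ⟨T₁.symm ≪≫ₗ T₂⟩

/-- **Surjectivity of `H_q(· | K) → H_q(· | L)` transfers between two open embeddings of a
neighbourhood of `L ⊆ K`** (Hatcher 2002, §3.3 p. 233). [cite: HatcherAT2002, §3.3 p. 233] -/
theorem surjective_restrictLocal_iff_of_isOpenEmbedding₂ {κ₁ : O → Y₁} {κ₂ : O → Y₂}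
    (h₁ : IsOpenEmbedding κ₁) (h₂ : IsOpenEmbedding κ₂) {K L : Set O} (hLK : L ⊆ K)
    (hK₁ : IsClosed (κ₁ '' K)) (hL₁ : IsClosed (κ₁ '' L))
    (hK₂ : IsClosed (κ₂ '' K)) (hL₂ : IsClosed (κ₂ '' L)) (q : ℕ) :
    Surjective (restrictLocal R M (Set.image_mono hLK) q :
        _ → localHomologyOfSet R M Y₁ (κ₁ '' L) q) ↔
      Surjective (restrictLocal R M (Set.image_mono hLK) q :
        _ → localHomologyOfSet R M Y₂ (κ₂ '' L) q) := by
  rw [← localHomologyOfSet.surjective_restrictLocal_iff_of_isOpenEmbedding R M h₁ hLK hK₁ hL₁ q,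
    localHomologyOfSet.surjective_restrictLocal_iff_of_isOpenEmbedding R M h₂ hLK hK₂ hL₂ q]

end Transfer

/-! ## Smooth discs -/

section Disc

variable {X : Type u} [TopologicalSpace X] [ChartedSpace (EuclideanSpace ℝ (Fin 4)) X]
  [T2Space X] [CompactSpace X] [IsManifold (𝓡 4) ∞ X]

/-- **Local homology of a closed smooth `4`-manifold along a smooth disc `D = f(𝔻²)` vanishes in
degrees `2, 3`**: an ambient isotopy shrinks `D` onto `f(r𝔻²)` inside the chart at `f 0`
(`exists_homeomorph_image_disc_eq`), where the local homology is that of `S⁴` along an injected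
square (acyclic complement, Hatcher Prop. 2B.1(a)).  (The tree's
`Knot.IsSliceDiscIn.isZero_localHomologyOfSet_disc`, with the datum unbundled.)
[cite: HatcherAT2002, Prop. 2B.1(a)] -/
theorem isZero_localHomologyOfSet_smoothDisc {f : EuclideanSpace ℝ (Fin 2) → X}
    (hf : ContMDiff (𝓡 2) (𝓡 4) ∞ f)
    (hinj : InjOn f (Metric.closedBall (0 : EuclideanSpace ℝ (Fin 2)) 1))
    (hd : ∀ y ∈ Metric.closedBall (0 : EuclideanSpace ℝ (Fin 2)) 1, Injective (mfderiv (𝓡 2) (𝓡 4) f y))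
    (R : Type) [CommRing R] (M : Type) [AddCommGroup M] [Module R M] {q : ℕ} (hq2 : 2 ≤ q) (hq3 : q ≤ 3) :
    IsZero (localHomologyOfSet R M X (f '' Metric.closedBall (0 : EuclideanSpace ℝ (Fin 2)) 1) q) := by
  -- shrink the disc into the chart at `f 0`
  set c := chartAt (EuclideanSpace ℝ (Fin 4)) (f 0) with hc
  obtain ⟨r, hr0, hr1, Ψ, hrW, hΨ⟩ := exists_homeomorph_image_disc_eq (n := 1) (m := 4) hf
    hinj hd c.open_source (mem_chart_source _ (f 0))
  set D' : Set X := f '' Metric.closedBall (0 : EuclideanSpace ℝ (Fin 2)) r with hD'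
  have hD'c : IsCompact D' := (isCompact_closedBall _ _).image hf.continuous
  have hD's : D' ⊆ c.source := hrW
  -- move along `Ψ`
  rw [isZero_iff_of_linearEquiv R (localHomologyOfSet.xEquiv R M Ψ
    (f '' Metric.closedBall (0 : EuclideanSpace ℝ (Fin 2)) 1) q), hΨ]
  -- the chart as an open embedding of its target
  set O : Set (EuclideanSpace ℝ (Fin 4)) := c.target with hO
  let κ₁ : O → X := fun o => c.symm o.1
  have hκ₁ : IsOpenEmbedding κ₁ := c.symm.isOpenEmbedding_restrict
  set K₁ : Set O := {o | c.symm o.1 ∈ D'} with hK₁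
  have hκ₁K : κ₁ '' K₁ = D' := by
    ext y
    constructor
    · rintro ⟨o, ho, rfl⟩
      exact ho
    · intro hy
      refine ⟨⟨c y, c.map_source (hD's hy)⟩, ?_, ?_⟩
      · change c.symm (c y) ∈ D'
        rwa [c.left_inv (hD's hy)]
      · change c.symm (c y) = y
        rw [c.left_inv (hD's hy)]
  rw [← hκ₁K, ← localHomologyOfSet.isZero_iff_of_isOpenEmbedding R M hκ₁ (by rw [hκ₁K]; exact hD'c.isClosed) q]
  -- into `S⁴`
  obtain ⟨σ, hσ⟩ := exists_isOpenEmbedding_euclidean_sphere_four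
  have hκ₂ : IsOpenEmbedding (σ ∘ (Subtype.val : O → EuclideanSpace ℝ (Fin 4))) :=
    hσ.comp c.open_target.isOpenEmbedding_subtypeVal
  -- the image is an injected square
  let ξ : (Fin 2 → unitInterval) → 𝕊⁴ :=
    fun x => σ (c (f (r • SphereComplement.cubeToBall x)))
  have hmem : ∀ z : Fin 2 → unitInterval, r • SphereComplement.cubeToBall z ∈
      Metric.closedBall (0 : EuclideanSpace ℝ (Fin 2)) 1 := fun z => by
    rw [mem_closedBall_zero_iff, norm_smul, Real.norm_eq_abs, abs_of_pos hr0]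
    nlinarith [SphereComplement.norm_cubeToBall_le (m := 2) z]
  have hfr : ∀ x : Fin 2 → unitInterval, f (r • SphereComplement.cubeToBall x) ∈ D' := fun x =>
    ⟨r • SphereComplement.cubeToBall x, by
      rw [mem_closedBall_zero_iff, norm_smul, Real.norm_eq_abs, abs_of_pos hr0]
      nlinarith [SphereComplement.norm_cubeToBall_le (m := 2) x], rfl⟩
  have hξc : Continuous ξ := by
    refine hσ.continuous.comp ?_
    refine c.continuousOn.comp_continuous
      (hf.continuous.comp (SphereComplement.continuous_cubeToBall.const_smul r))
      fun x => hD's (hfr x)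
  have hξi : Injective ξ := by
    intro x y hxy
    have h1 : c (f (r • SphereComplement.cubeToBall x)) = c (f (r • SphereComplement.cubeToBall y)) :=
      hσ.injective hxy
    have h2 : f (r • SphereComplement.cubeToBall x) = f (r • SphereComplement.cubeToBall y) :=
      c.injOn (hD's (hfr x)) (hD's (hfr y)) h1
    have h3 := hinj (hmem x) (hmem y) h2
    exact SphereComplement.cubeToBall_injective (smul_right_injective _ hr0.ne' h3)
  have hξK : (σ ∘ (Subtype.val : O → EuclideanSpace ℝ (Fin 4))) '' K₁ = range ξ := by
    ext s
    constructor
    · rintro ⟨o, ho, rfl⟩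
      obtain ⟨z, hz, hzo⟩ : c.symm o.1 ∈ D' := ho
      obtain ⟨x, rfl⟩ : z ∈ range (fun x : Fin 2 → unitInterval => r • SphereComplement.cubeToBall x) := by
        rw [show range (fun x : Fin 2 → unitInterval => r • SphereComplement.cubeToBall x) =
            Metric.closedBall 0 r from ?_]
        · exact hz
        rw [show (fun x : Fin 2 → unitInterval => r • SphereComplement.cubeToBall x) =
            (fun y => r • y) ∘ SphereComplement.cubeToBall from rfl, range_comp,
          SphereComplement.range_cubeToBall, Set.image_smul, smul_closedBall' hr0.ne', smul_zero,
          Real.norm_eq_abs, abs_of_pos hr0, mul_one]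
      refine ⟨x, ?_⟩
      change σ (c (f (r • SphereComplement.cubeToBall x))) = σ o.1
      rw [hzo, c.right_inv o.2]
    · rintro ⟨x, rfl⟩
      refine ⟨⟨c (f (r • SphereComplement.cubeToBall x)), c.map_source (hD's (hfr x))⟩, ?_, rfl⟩
      change c.symm (c (f (r • SphereComplement.cubeToBall x))) ∈ D'
      rw [c.left_inv (hD's (hfr x))]
      exact hfr x
  have hclosed : IsClosed ((σ ∘ (Subtype.val : O → EuclideanSpace ℝ (Fin 4))) '' K₁) := by
    rw [hξK]
    exact (isCompact_range hξc).isClosed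
  rw [localHomologyOfSet.isZero_iff_of_isOpenEmbedding R M hκ₂ hclosed q, hξK]
  exact isZero_localHomologyOfSet_sphere_four_of_acyclic_compl R M
    (isZero_singularHomology_compl_range_cube_sphere_four R M ⟨ξ, hξc⟩ hξi) hq2 hq3

end Disc

/-! ## Discs in `ℝ⁴` seen in `S⁴` -/

section SphereDisc

/-- **`H_q(S⁴ | σ f(𝔻²)) = 0` (`q = 2, 3`)** for an injective continuous disc `f|_{𝔻²}` in `ℝ⁴` and
an injective continuous `σ : ℝ⁴ → S⁴`: the image is an injected square, whose complement is acyclic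
(Hatcher Prop. 2B.1(a)). [cite: HatcherAT2002, Prop. 2B.1(a)] -/
theorem isZero_localHomologyOfSet_sphere_image_disc
    {σ : EuclideanSpace ℝ (Fin 4) → 𝕊⁴} (hσc : Continuous σ) (hσi : Injective σ)
    {f : EuclideanSpace ℝ (Fin 2) → EuclideanSpace ℝ (Fin 4)} (hf : Continuous f)
    (hinj : InjOn f (Metric.closedBall (0 : EuclideanSpace ℝ (Fin 2)) 1))
    (R : Type) [CommRing R] (M : Type) [AddCommGroup M] [Module R M] {q : ℕ} (hq2 : 2 ≤ q) (hq3 : q ≤ 3) :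
    IsZero (localHomologyOfSet R M 𝕊⁴
      (σ '' (f '' Metric.closedBall (0 : EuclideanSpace ℝ (Fin 2)) 1)) q) := by
  let ξ : (Fin 2 → unitInterval) → 𝕊⁴ := fun x => σ (f (SphereComplement.cubeToBall x))
  have hξc : Continuous ξ := hσc.comp (hf.comp SphereComplement.continuous_cubeToBall)
  have hmem : ∀ z : Fin 2 → unitInterval, SphereComplement.cubeToBall z ∈
      Metric.closedBall (0 : EuclideanSpace ℝ (Fin 2)) 1 := fun z => by
    rw [← SphereComplement.range_cubeToBall]
    exact mem_range_self z
  have hξi : Injective ξ := fun x y hxy =>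
    SphereComplement.cubeToBall_injective (hinj (hmem x) (hmem y) (hσi hxy))
  have hξK : σ '' (f '' Metric.closedBall (0 : EuclideanSpace ℝ (Fin 2)) 1) = range ξ := by
    rw [← SphereComplement.range_cubeToBall (m := 2), ← range_comp, ← range_comp]
    rfl
  rw [hξK]
  exact isZero_localHomologyOfSet_sphere_four_of_acyclic_compl R M
    (isZero_singularHomology_compl_range_cube_sphere_four R M ⟨ξ, hξc⟩ hξi) hq2 hq3

end SphereDisc

end FriendsH2

/-- **Registered helper (aux 3 of `stub_friendsH2`)**: a germ chart of the model handlebody (smooth, injective, immersive on an open set `U`) is an open embedding of `U` (inverse function theorem, Lee 2013 Thm. 4.5). [cite: LeeSmoothManifolds2013, Thm. 4.5] -/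
theorem helper_friendsH2_germChart : ∀ (X : Type) [TopologicalSpace X] [ChartedSpace (EuclideanSpace ℝ (Fin 4)) X] [IsManifold (𝓡 4) ((⊤ : ℕ∞) : WithTop ℕ∞) X] (U : Set (EuclideanSpace ℝ (Fin 4))) (i : EuclideanSpace ℝ (Fin 4) → X), IsOpen U → ContMDiffOn (𝓡 4) (𝓡 4) ((⊤ : ℕ∞) : WithTop ℕ∞) i U → Set.InjOn i U → (∀ x ∈ U, Function.Injective (mfderiv (𝓡 4) (𝓡 4) i x)) → Topology.IsOpenEmbedding (U.restrict i) := fun _ _ _ _ _ _ hU hi hinj hd =>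
  FriendsH2.isOpenEmbedding_restrict_of_germChart hU hi hinj hd

end Summit.SmoothPoincare4.SmoothPoincare4.Theorems.DcrGap.MkFriends

end
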